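import Summits.RiemannHypothesis.RiemannHypothesis.Theorems.TiltedLandingLaw421R3GenusOneLogDeriv3

/-!
# TwoPointExact (C4 «kernel desk» rh-idea-6 g42, W-09 F-LINK) — the tree's genus-one TWO-POINT LAW of a cofactor with the PHASE KEPT

ONE theorem (K, standard axioms), ONE tree import (`…R3GenusOneLogDeriv3`, C3 g41).  `twoPoint_exact_dslope` is C3 g41's
`Literature.Analysis.Complex.GenusOneLogDerivC3g41.twoPoint_bound_dslope` RE-RUN with ONE more export over the SAME zero list: besides the
multiplicity clauses (`m = 1`, `ncard = analyticOrderNatAt`, `HasSum` re-indexing, every zero listed) and the NORM bound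
`‖h′/h (z) − h′/h (w)‖ ≤ ‖z − w‖·Σ'ᵢ 1/(‖z − aᵢ‖‖w − aᵢ‖)` for the cofactor `h = dslope F v` of an entire `F` of order `< 2` at a zero `v` with
`F′ v ≠ 0`, it gives the EXACT identity `h′/h (z) − h′/h (w) = Σ'ᵢ (1/(z − aᵢ) − 1/(w − aᵢ))` (complex, summable) — the tree's zero form
`logDeriv_sub_logDeriv_eq_tsum_zeros` (part 2) transported through the translation `x ↦ h (x + v)` exactly as part 3 transports the norm bound
(proof = part 3's, verbatim, + one bullet; the END-summability clause of part 3 is not re-exported; hypothesis `deriv F v ≠ 0` replaces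
`analyticOrderAt F v = 1`).  WHY (C3 g54 LPGAIN (B3)): the far branch's gain must be priced WITH ITS PHASE — the phase-free two-point sum prices
at `.1302·η/s > .118` on the legal `R = 60` witness whose true gain is `.031`; consumer = C4 «FarTwoPoint» (`RhW08.GainTwoPoint.farList_twoPoint`).
Nothing here bears on the truth of RH; ⟨33346⟩/⟨33347⟩ OPEN.
-/

noncomputable section

namespace RhW08.TwoPointExact

open Complex Filter Topology Set
open Literature.Analysis.Complex Literature.Analysis.Complex.GenusOneLogDerivC3g41
open Literature.NumberTheory.LFunctions.BurnolVectors (differentiable_dslope)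

/-- ★ (K) **THE TREE'S TWO-POINT LAW WITH THE PHASE KEPT.** `…GenusOneLogDerivC3g41.twoPoint_bound_dslope` (C3 g41) re-run with ONE
more export: besides the norm bound, the EXACT two-point identity of the cofactor `h = dslope F v`
`h′/h (z) − h′/h (w) = Σ'ᵢ (1/(z − aᵢ) − 1/(w − aᵢ))` (complex, summable) over the SAME list — the tree's zero-form identity
`logDeriv_sub_logDeriv_eq_tsum_zeros` transported through the translation `x ↦ h (x + v)` exactly as the norm bound is. -/
theorem twoPoint_exact_dslope {F : ℂ → ℂ} {C ρ : ℝ} (hF : Differentiable ℂ F)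
    (hgrowth : ∀ z, ‖F z‖ ≤ C * Real.exp (‖z‖ ^ ρ)) (hρ : ρ < 2) {v : ℂ} (hv : F v = 0)
    (hv1 : deriv F v ≠ 0) :
    ∃ (ι : Type) (a : ι → ℂ) (m : ι → ℝ), (∀ i, 0 ≤ m i) ∧ (∀ i, F (a i) = 0 ∧ a i ≠ v) ∧
      (∀ i, m i = 1) ∧ (∀ c : ℂ, {i | a i = c}.ncard = analyticOrderNatAt (dslope F v) c) ∧
      (∀ g : ℂ → ℝ, Summable (fun i ↦ m i * g (a i)) →
        HasSum (fun c : ℂ ↦ (analyticOrderNatAt (dslope F v) c : ℝ) * g c) (∑' i, m i * g (a i))) ∧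
      (∀ z, dslope F v z = 0 → ∃ i, z = a i ∧ 0 < m i) ∧
      ∀ z w, dslope F v z ≠ 0 → dslope F v w ≠ 0 →
        (Summable (fun i ↦ m i / (‖z - a i‖ * ‖w - a i‖)) ∧
        ‖deriv (dslope F v) z / dslope F v z - deriv (dslope F v) w / dslope F v w‖ ≤
          ‖z - w‖ * ∑' i, m i / (‖z - a i‖ * ‖w - a i‖)) ∧
        Summable (fun i ↦ (1 / (z - a i) - 1 / (w - a i))) ∧
        deriv (dslope F v) z / dslope F v z - deriv (dslope F v) w / dslope F v w = ∑' i, (1 / (z - a i) - 1 / (w - a i)) := by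
  -- the cofactor and its translate
  set h : ℂ → ℂ := dslope F v with hh
  have hhd : Differentiable ℂ h := differentiable_dslope hF v
  have hhv : h v ≠ 0 := by
    rw [hh, dslope_same]
    exact hv1
  -- growth of `h`, exponent `σ = max ρ 0`
  obtain ⟨C₁, hC₁, hg₁⟩ := growth_nonneg_exponent hF hgrowth
  set σ : ℝ := max ρ 0 with hσ
  have hσ0 : 0 ≤ σ := le_max_right _ _
  have hσ2 : σ < 2 := max_lt hρ (by norm_num)
  have hgh : ∀ z, ‖h z‖ ≤ (C₁ * Real.exp ((‖v‖ + 1) ^ σ)) * Real.exp (‖z‖ ^ σ) :=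
    fun z ↦ norm_dslope_le hF hσ0 hg₁ hv z
  set G : ℂ → ℂ := fun x ↦ h (x + v) with hGdef
  have hGd : Differentiable ℂ G := hhd.comp (differentiable_id.add_const v)
  set σ' : ℝ := (σ + 2) / 2 with hσ'
  have hσσ' : σ < σ' := by rw [hσ']; linarith
  have hσ'2 : σ' < 2 := by rw [hσ']; linarith
  obtain ⟨C₂, hg₂⟩ := growth_translate hσ0 (by positivity) hgh v hσσ'
  have hG0 : G 0 ≠ 0 := by simpa [hGdef] using hhv
  obtain ⟨b, hb, hzero, hmult, hprod⟩ := hadamard_genus_one_zeros G σ' C₂ hGd hσ'2 hg₂ hG0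
  -- multiplicities (verbatim from the tree's part 3)
  have hcard : ∀ c : ℂ, ({i : {n : ℕ // b n ≠ 0} | v + (b i.1)⁻¹ = c} : Set _).ncard =
      analyticOrderNatAt h c := by
    intro c
    have hcomp : analyticOrderNatAt G (c - v) = analyticOrderNatAt h c := by
      unfold analyticOrderNatAt
      congr 1
      have hG' : G = h ∘ (fun x ↦ x + v) := rfl
      rw [hG', analyticOrderAt_comp_of_deriv_ne_zero (by fun_prop) (by simp), sub_add_cancel]
    rw [show ({i : {n : ℕ // b n ≠ 0} | v + (b i.1)⁻¹ = c} : Set _) =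
        {i : {n : ℕ // b n ≠ 0} | (i : ℕ) ∈ {n : ℕ | v + (b n)⁻¹ = c}} from rfl,
      Set.ncard_subtype, ← hcomp]
    by_cases hcv : c = v
    · rw [hcv, sub_self]
      have hempty : ({n : ℕ | v + (b n)⁻¹ = v} ∩ setOf fun n ↦ b n ≠ 0) = ∅ := by
        ext n
        simp
      rw [hempty, Set.ncard_empty]
      unfold analyticOrderNatAt
      rw [((hGd.analyticAt 0).analyticOrderAt_eq_zero).2 hG0]
      simp
    · have hα : c - v ≠ 0 := sub_ne_zero.2 hcv
      rw [← hmult (c - v) hα]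
      congr 1
      ext n
      simp only [Set.mem_inter_iff, Set.mem_setOf_eq]
      constructor
      · rintro ⟨h1, -⟩
        have h2 : (b n)⁻¹ = c - v := by rw [← h1]; ring
        rw [← h2, inv_inv]
      · intro h1
        refine ⟨?_, ?_⟩
        · rw [h1, inv_inv]
          ring
        · rw [h1]
          exact inv_ne_zero hα
  -- `logDeriv G x = h'/h (x + v)`
  have hlogG : ∀ x : ℂ, logDeriv G x = deriv h (x + v) / h (x + v) := by
    intro x
    rw [logDeriv_apply, hGdef]
    simp only [deriv_comp_add_const]
  -- the index type: genuine inverse zeros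
  refine ⟨{n : ℕ // b n ≠ 0}, fun i ↦ v + (b i.1)⁻¹, fun _ ↦ 1, fun _ ↦ zero_le_one,
    fun i ↦ ?_, fun _ ↦ rfl, hcard, fun g hg ↦ ?_, fun z hz ↦ ?_, fun z w hz hw ↦ ⟨?_, ?_⟩⟩
  · -- zeros of `F` off `v`
    have hi : G (b i.1)⁻¹ = 0 := hzero i.1 i.2
    have hne : v + (b i.1)⁻¹ ≠ v := by
      intro e
      have : (b i.1)⁻¹ = 0 := by simpa using e
      exact i.2 (inv_eq_zero.1 this)
    refine ⟨?_, hne⟩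
    have hi' : h (v + (b i.1)⁻¹) = 0 := by simpa [hGdef, add_comm] using hi
    have := sub_smul_dslope F v (v + (b i.1)⁻¹)
    rw [hv, sub_zero, ← hh, hi', smul_zero] at this
    exact this.symm
  · -- fiber formula with multiplicities
    have h1 : (fun i : {n : ℕ // b n ≠ 0} ↦ (1 : ℝ) * g (v + (b i.1)⁻¹)) =
        fun i ↦ g (v + (b i.1)⁻¹) := by
      funext i
      rw [one_mul]
    rw [h1] at hg ⊢
    have h2 := hasSum_fiber_ncard (fun i : {n : ℕ // b n ≠ 0} ↦ v + (b i.1)⁻¹) g hg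
    have hfun : (fun c : ℂ ↦ (({i : {n : ℕ // b n ≠ 0} | v + (b i.1)⁻¹ = c} : Set _).ncard : ℝ) * g c) =
        fun c ↦ (analyticOrderNatAt h c : ℝ) * g c := by
      funext c
      rw [hcard c]
    rw [hfun] at h2
    exact h2
  · -- every zero of `h` is listed
    have hzv : z ≠ v := by intro e; rw [e] at hz; exact hhv hz
    have hGz : G (z - v) = 0 := by simpa [hGdef] using hz
    have hpos := analyticOrderNatAt_pos_of_zero hGd hG0 hGz
    have hzv' : z - v ≠ 0 := sub_ne_zero.2 hzv
    have hcard : {n : ℕ | b n = (z - v)⁻¹}.ncard ≠ 0 := by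
      rw [hmult (z - v) hzv']
      exact Nat.pos_iff_ne_zero.1 hpos
    obtain ⟨n, hn⟩ := Set.nonempty_of_ncard_ne_zero hcard
    have hbn : b n ≠ 0 := by
      rw [Set.mem_setOf_eq] at hn
      rw [hn]; exact inv_ne_zero hzv'
    refine ⟨⟨n, hbn⟩, ?_, zero_lt_one⟩
    simp only [Set.mem_setOf_eq] at hn
    simp only [hn, inv_inv]
    ring
  · -- the two-point NORM bound, transported from `G` (verbatim from the tree's part 3)
    have hGz : G (z - v) ≠ 0 := by simpa [hGdef] using hz
    have hGw : G (w - v) ≠ 0 := by simpa [hGdef] using hw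
    have hmain := norm_logDeriv_sub_logDeriv_le hG0 hb hprod hGz hGw (hGd _) (hGd _)
    rw [hlogG, hlogG] at hmain
    simp only [sub_add_cancel] at hmain
    set g : ℕ → ℝ := fun n ↦ ‖b n‖ ^ 2 / (‖1 - b n * (z - v)‖ * ‖1 - b n * (w - v)‖) with hgdef
    have hgs : Summable g := summable_twoPoint_terms hb (z - v) (w - v)
    have hsupp : Function.support g ⊆ {n : ℕ | b n ≠ 0} := by
      intro n hn
      simp only [Function.mem_support, ne_eq, hgdef] at hn
      intro hb0
      apply hn
      simp [hb0]
    have hgi : ∀ i : {n : ℕ // b n ≠ 0},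
        g i.1 = 1 / (‖z - (v + (b i.1)⁻¹)‖ * ‖w - (v + (b i.1)⁻¹)‖) := by
      intro i
      have hb0 : b i.1 ≠ 0 := i.2
      have e1 : ∀ u : ℂ, ‖1 - b i.1 * (u - v)‖ = ‖b i.1‖ * ‖u - (v + (b i.1)⁻¹)‖ := by
        intro u
        rw [← norm_mul, ← norm_neg (b i.1 * _)]
        congr 1
        field_simp
        ring
      simp only [hgdef, e1]
      have hbpos : 0 < ‖b i.1‖ := norm_pos_iff.2 hb0
      field_simp
    have hsum_eq : ∑' i : {n : ℕ // b n ≠ 0}, (1 : ℝ) / (‖z - (v + (b i.1)⁻¹)‖ * ‖w - (v + (b i.1)⁻¹)‖)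
        = ∑' n, g n := by
      rw [← tsum_subtype_eq_of_support_subset hsupp]
      exact tsum_congr fun i ↦ (hgi i).symm
    have hsumm : Summable fun i : {n : ℕ // b n ≠ 0} ↦
        (1 : ℝ) / (‖z - (v + (b i.1)⁻¹)‖ * ‖w - (v + (b i.1)⁻¹)‖) := by
      have := hgs.subtype {n : ℕ | b n ≠ 0}
      refine this.congr fun i ↦ ?_
      exact hgi i
    refine ⟨hsumm, ?_⟩
    rw [hsum_eq]
    have hzw : ‖z - v - (w - v)‖ = ‖z - w‖ := by congr 1; ring
    rw [hzw] at hmain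
    exact hmain
  · -- the EXACT two-point identity, transported from `G` (the tree's zero form `logDeriv_sub_logDeriv_eq_tsum_zeros`)
    have hGz : G (z - v) ≠ 0 := by simpa [hGdef] using hz
    have hGw : G (w - v) ≠ 0 := by simpa [hGdef] using hw
    obtain ⟨hS, hI⟩ := logDeriv_sub_logDeriv_eq_tsum_zeros hG0 hb hprod hGz hGw (hGd _) (hGd _)
    rw [hlogG, hlogG] at hI
    simp only [sub_add_cancel] at hI
    set gc : ℕ → ℂ := fun n ↦ ((mult b n : ℝ) : ℂ) * (1 / (z - v - (b n)⁻¹) - 1 / (w - v - (b n)⁻¹)) with hgcdef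
    have hsupp : Function.support gc ⊆ {n : ℕ | b n ≠ 0} := by
      intro n hn
      simp only [Function.mem_support, ne_eq, hgcdef] at hn
      intro hb0
      apply hn
      simp [mult, hb0]
    have hgi : ∀ i : {n : ℕ // b n ≠ 0},
        gc i.1 = 1 / (z - (v + (b i.1)⁻¹)) - 1 / (w - (v + (b i.1)⁻¹)) := by
      intro i
      have hb0 : b i.1 ≠ 0 := i.2
      have hm : mult b i.1 = 1 := by simp [mult, hb0]
      simp only [hgcdef, hm, Complex.ofReal_one, one_mul]
      congr 2 <;> ring
    have hsum_eq : ∑' i : {n : ℕ // b n ≠ 0}, (1 / (z - (v + (b i.1)⁻¹)) - 1 / (w - (v + (b i.1)⁻¹)))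
        = ∑' n, gc n := by
      rw [← tsum_subtype_eq_of_support_subset hsupp]
      exact tsum_congr fun i ↦ (hgi i).symm
    have hsumm : Summable fun i : {n : ℕ // b n ≠ 0} ↦
        (1 / (z - (v + (b i.1)⁻¹)) - 1 / (w - (v + (b i.1)⁻¹))) := by
      have := hS.subtype {n : ℕ | b n ≠ 0}
      refine this.congr fun i ↦ ?_
      exact hgi i
    refine ⟨hsumm, ?_⟩
    rw [hsum_eq]
    exact hI

end RhW08.TwoPointExact

end
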